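import Mathlib.Analysis.Normed.Operator.Compact.FredholmAlternative
import Literature.Analysis.OperatorTheory.PeetreLemma
import HarnessLib

/-!
# Closed range of `T - μ • 1` for a compact operator `T` and of compact perturbations of an
# isomorphism (F. Riesz 1918; Riesz–Schauder theory)

Topic `Literature/Analysis/OperatorTheory`. Proofs-layer file (Mathlib and
`Literature.Analysis.OperatorTheory.PeetreLemma` only; theorems only, no definitions, no named
facts).

For a compact operator `T` on a Banach space `X` over a nontrivially normed field and a scalar
`μ ≠ 0`, the operator `S = T - μ • 1` has CLOSED range (F. Riesz 1918; Brezis, Thm. 6.6 (b);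
Rudin, *Functional Analysis*, Ch. 4; Kreyszig §8.3; the range half of the statement "`T - μ` is
semi-Fredholm"). Together with the Fredholm alternative (Mathlib's
`IsCompactOperator.hasEigenvalue_or_mem_resolventSet` and the tree's
`Literature.Analysis.OperatorTheory.injective_of_surjective_of_isCompactOperator`) this is what
makes the cokernel of `T - μ` at an eigenvalue `μ` VISIBLE from any dense set of test vectors:
a closed proper subspace misses some element of every dense subset.

* `norm_le_inv_mul_norm_sub_smul_add` — the tautological a priori estimate
  `‖x‖ ≤ ‖μ‖⁻¹ (‖(T - μ • 1) x‖ + ‖T x‖)` (`μ • x = T x - (T - μ • 1) x`);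
* `isClosed_range_sub_smul_of_isCompactOperator` — **`T - μ • 1` has closed range** for `T`
  compact, `μ ≠ 0`, `X` complete: Peetre's lemma `Peetre.isClosed_range` (an a priori estimate
  modulo a compact map forces closed range — Lions–Magenes, Ch. 2, Lemma 5.1, vendored in
  `PeetreLemma`) applied to the estimate above with the compact map `K = T`;
* `isClosed_range_of_isCompactOperator_sub` — the same for a compact perturbation `S` of a linear
  homeomorphism `J : X ≃L[𝕜] Y` (`S - J` compact, `X` complete): `S = J ∘ (K₀ - (-1) • 1)` with
  `K₀ = J⁻¹ (S - J)` compact, and `J` is a closed map;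
* `exists_mem_forall_ne_of_isClosed_range_of_dense` — a map with closed, proper range misses an
  element of every dense set;
* `exists_not_mem_range_sub_smul_of_dense`, `exists_not_mem_range_of_dense` — **consumer form**:
  if `T - μ • 1` (resp. the compact perturbation `S` of `J`) is not onto, then every dense subset
  `D` contains a vector outside its range (e.g. `D` = finitely supported sequences, trigonometric
  polynomials, smooth fields).

Mathlib search: `lean search 'isClosed_range.*[Cc]ompact|IsClosed.*range \(T - '` — nothing in
Mathlib (`Mathlib.Analysis.Normed.Operator.Compact.FredholmAlternative` has
`antilipschitz_of_not_hasEigenvalue`, i.e. closed range only when `μ` is NOT an eigenvalue); in the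
tree, `Literature.Analysis.OperatorTheory.Peetre.isClosed_range` (general a priori estimates) and
`finiteDimensional_ker_one_sub_and_isClosed_range` (`NullityUpperSemicontinuous`, the case
`1 - K` over `RCLike` only). Used: `Peetre.isClosed_range`,
`Peetre.totallyBounded_image_of_isCompactOperator`, `IsCompactOperator.clm_comp`,
`ContinuousLinearEquiv.isClosed_image`, `Dense.closure_eq`.

## References

* F. Riesz, *Über lineare Funktionalgleichungen*, Acta Math. 41 (1918) 71–98.
* H. Brezis, *Functional Analysis, Sobolev Spaces and Partial Differential Equations* (2011),
  Thm. 6.6 (b): `R(I - T)` is closed for compact `T`. [Brezis2011]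
* W. Rudin, *Functional Analysis*, 2nd ed. (1991), Ch. 4 (compact operators: `T - λI` has closed
  range; the Riesz–Schauder theorem). [Rudin1991]
* M. Reed, B. Simon, *Methods of Modern Mathematical Physics I* (1980), §VI.5, Thm. VI.15
  (Riesz–Schauder) and the Fredholm alternative. [ReedSimonI1980]
* J.-L. Lions, E. Magenes, *Non-Homogeneous Boundary Value Problems and Applications I* (1972),
  Ch. 2, Lemma 5.1 (Peetre's lemma).
-/

open Set

namespace Literature.Analysis.OperatorTheory

/-! ### Closed proper ranges miss every dense set -/

/-- A map with closed range which is not onto misses an element of every dense subset of the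
target: if `D ⊆ range f` then `univ = closure D ⊆ range f`. [folklore] -/
theorem exists_mem_forall_ne_of_isClosed_range_of_dense {α β : Type*} [TopologicalSpace β]
    {f : α → β} (hf : IsClosed (range f)) (hsurj : ¬ Function.Surjective f) {D : Set β}
    (hD : Dense D) : ∃ e ∈ D, ∀ x, f x ≠ e := by
  by_contra! h
  refine hsurj (range_eq_univ.1 (eq_univ_of_univ_subset ?_))
  rw [← hD.closure_eq]
  exact hf.closure_subset_iff.2 fun e he ↦ h e he

/-! ### `T - μ • 1` for a compact `T` -/

section Field

variable {𝕜 X : Type*} [NontriviallyNormedField 𝕜] [NormedAddCommGroup X] [NormedSpace 𝕜 X]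

/-- The tautological a priori estimate for `S = T - μ • 1`, `μ ≠ 0`:
`‖x‖ ≤ ‖μ‖⁻¹ (‖S x‖ + ‖T x‖)`, since `μ • x = T x - S x`. This is the hypothesis of Peetre's
lemma for the pair `(S, T)`. [folklore] -/
theorem norm_le_inv_mul_norm_sub_smul_add (T : X →L[𝕜] X) {μ : 𝕜} (hμ : μ ≠ 0) (x : X) :
    ‖x‖ ≤ ‖μ‖⁻¹ * (‖(T - μ • 1) x‖ + ‖T x‖) := by
  have hμ' : 0 < ‖μ‖ := norm_pos_iff.2 hμ
  rw [le_inv_mul_iff₀ hμ', ← norm_smul]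
  have hx : μ • x = T x - (T - μ • 1) x := by simp
  rw [hx]
  exact (norm_sub_le _ _).trans_eq (add_comm _ _)

variable [CompleteSpace X] {T : X →L[𝕜] X} {μ : 𝕜}

/-- **The range of `T - μ • 1` is closed** for a compact operator `T` on a Banach space over a
nontrivially normed field and `μ ≠ 0` (F. Riesz 1918; Brezis, Thm. 6.6 (b); Rudin, *Functional
Analysis*, Ch. 4). Proof: the estimate `‖x‖ ≤ ‖μ‖⁻¹ (‖(T - μ • 1) x‖ + ‖T x‖)`
(`norm_le_inv_mul_norm_sub_smul_add`) is an a priori estimate modulo the compact map `T`, so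
Peetre's lemma (`Peetre.isClosed_range`: the induced injection `X ⧸ ker (T - μ) → X` is bounded
below, by compactness, hence has closed range) applies. [cite: Brezis2011, Thm. 6.6] -/
theorem isClosed_range_sub_smul_of_isCompactOperator (hT : IsCompactOperator T) (hμ : μ ≠ 0) :
    IsClosed (Set.range (T - μ • 1 : X →L[𝕜] X)) :=
  Peetre.isClosed_range (A := T - μ • 1) (K := T) (norm_le_inv_mul_norm_sub_smul_add T hμ)
    fun _ hs ↦ Peetre.totallyBounded_image_of_isCompactOperator hT hs

/-- Submodule form: the range `LinearMap.range (T - μ • 1)` of `T - μ • 1` is a closed subspace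
for `T` compact on a Banach space and `μ ≠ 0`. [folklore] -/
theorem isClosed_linearMapRange_sub_smul_of_isCompactOperator (hT : IsCompactOperator T)
    (hμ : μ ≠ 0) :
    IsClosed ((LinearMap.range ((T - μ • 1 : X →L[𝕜] X) : X →ₗ[𝕜] X) : Submodule 𝕜 X) : Set X) := by
  rw [LinearMap.coe_range, ContinuousLinearMap.coe_coe]
  exact isClosed_range_sub_smul_of_isCompactOperator hT hμ

/-- **Vectors outside the range of `T - μ • 1` can be taken from any dense set**: if `T` is a
compact operator on a Banach space, `μ ≠ 0` and `T - μ • 1` is not onto (equivalently, by the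
Fredholm alternative, `μ` is an eigenvalue of `T`), then every dense subset `D ⊆ X` contains some
`e` with `(T - μ • 1) x ≠ e` for all `x` (the range is a closed proper subspace,
`isClosed_range_sub_smul_of_isCompactOperator`). [folklore] -/
theorem exists_not_mem_range_sub_smul_of_dense (hT : IsCompactOperator T) (hμ : μ ≠ 0)
    (hS : ¬ Function.Surjective (T - μ • 1 : X →L[𝕜] X)) {D : Set X} (hD : Dense D) :
    ∃ e ∈ D, ∀ x, (T - μ • 1 : X →L[𝕜] X) x ≠ e :=
  exists_mem_forall_ne_of_isClosed_range_of_dense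
    (isClosed_range_sub_smul_of_isCompactOperator hT hμ) hS hD

end Field

/-! ### Compact perturbations of a linear homeomorphism -/

section Perturbation

variable {𝕜 X Y : Type*} [NontriviallyNormedField 𝕜] [NormedAddCommGroup X] [NormedSpace 𝕜 X]
  [CompleteSpace X] [NormedAddCommGroup Y] [NormedSpace 𝕜 Y]

/-- **A compact perturbation of an isomorphism has closed range**: if `J : X ≃L[𝕜] Y` is a linear
homeomorphism from a Banach space `X` to a normed space `Y` and `S - J` is a compact operator,
then `range S` is closed. Indeed `S = J ∘ (K₀ - (-1) • 1)` with `K₀ = J⁻¹ ∘ (S - J)` compact on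
`X`, so `range S = J '' range (K₀ - (-1) • 1)` is the image of a closed set
(`isClosed_range_sub_smul_of_isCompactOperator`) under the homeomorphism `J`. [folklore] -/
theorem isClosed_range_of_isCompactOperator_sub (S : X →L[𝕜] Y) (J : X ≃L[𝕜] Y)
    (hK : IsCompactOperator (S - (J : X →L[𝕜] Y) : X →L[𝕜] Y)) :
    IsClosed (Set.range S) := by
  set K₀ : X →L[𝕜] X := (J.symm : Y →L[𝕜] X) ∘L (S - (J : X →L[𝕜] Y)) with hK₀
  have hK₀c : IsCompactOperator K₀ := hK.clm_comp (J.symm : Y →L[𝕜] X)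
  have hS : ∀ x, S x = J ((K₀ - (-1 : 𝕜) • 1) x) := by
    intro x
    simp [hK₀]
  have hrange : Set.range S = J '' Set.range (K₀ - (-1 : 𝕜) • 1 : X →L[𝕜] X) := by
    rw [← Set.range_comp]
    exact congrArg Set.range (funext hS)
  rw [hrange, ContinuousLinearEquiv.isClosed_image]
  exact isClosed_range_sub_smul_of_isCompactOperator hK₀c (neg_ne_zero.2 one_ne_zero)

/-- **Vectors outside the range of a compact perturbation of an isomorphism can be taken from any
dense set**: if `S - J` is compact for a linear homeomorphism `J : X ≃L[𝕜] Y` (`X` Banach) and `S`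
is not onto — e.g. `S` has a non-trivial kernel, by the Fredholm alternative
`injective_of_surjective_of_isCompactOperator_sub` — then every dense subset `D ⊆ Y` contains some
`e` with `S x ≠ e` for all `x`: `range S` is a closed (`isClosed_range_of_isCompactOperator_sub`)
proper subset, and a closed set containing a dense set is everything. (Consumed with `D` = the
finitely supported lattice vectors, i.e. trigonometric polynomials, to produce SMOOTH directions
transverse to the range of a degenerate linearised operator.) [folklore] -/
theorem exists_not_mem_range_of_dense (S : X →L[𝕜] Y) (J : X ≃L[𝕜] Y)
    (hK : IsCompactOperator (S - (J : X →L[𝕜] Y) : X →L[𝕜] Y)) (hS : ¬ Function.Surjective S)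
    {D : Set Y} (hD : Dense D) : ∃ e ∈ D, ∀ x, S x ≠ e :=
  exists_mem_forall_ne_of_isClosed_range_of_dense (isClosed_range_of_isCompactOperator_sub S J hK)
    hS hD

end Perturbation

end Literature.Analysis.OperatorTheory
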